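import Literature.Probability.RandomPlanarGeometry.HexSAWPolygonCellsOmegaRec
import HarnessLib

/-!
# Cell calculus for honeycomb polygon surgery, XXXIII: the closed form of the recursive OMEGA map

Topic `Literature/Probability/RandomPlanarGeometry` (lane «pcv-sawmu», a-p4 g22; sequel of XXII `…CellsOmegaRec` (`omegaRec`) and XII `…CellsStickDecomp`
(`urIter`, the stick decomposition above the peel)).

First third of THEOREM I (injectivity of the step-two injection, `HOME/pub-sawmu-a-p4/g21/omega/THEOREM-OMEGA-g21.md` §4; DESIGN-BRIDGE-g22 §3 (b)):
the recursion `omegaRec C P₀` — peel the top spike `m`, map the rest, re-attach a hexagon at the port of `LL m`, move the port of `m` to `UR` of it — has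
the ORDER-FREE closed form «base image plus rays»:
* `omegaRec_port_eq_base` — hexagons that are not peeled keep their base port `P₀ (peel S)`;
* `omegaRec_port_eq_ur` — the port of a peeled hexagon `m` is `UR` of the port of `LL m`;
* `omegaRec_port_urIter` — hence along a stick `h, UR h, UR² h, …` the ports are `P₀ (peel S) h, UR (P₀ h), UR² (P₀ h), …`;
* ★ `omegaRec_image_eq` — `(omegaRec C P₀ S).1 = C (peel S) ∪ (S \ peel S).image (m ↦ LL (port m))`: the image is the base image together with, for
  every stick of length `ℓ` on a host `h`, the ray `P₀ h, UR (P₀ h), …, UR^{ℓ−1} (P₀ h)` (`mem_omegaRec_iff`).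
All four are structural (no brick-set hypothesis): they only use that the peeled hexagon is the top one, so that no later step touches `LL m`.

Sources: N. Madras, G. Slade, *The Self-Avoiding Walk* (1993), §3.2, proof of Theorem 3.2.3 [MadrasSlade1993]; I. Jensen, J. Phys.: Conf. Ser. 42 (2006) 163
[Jensen2006HoneycombPolygons].  Label (lane): LANE INFRASTRUCTURE for the lane's step-two injection; nothing new in writing.
-/

open Finset

namespace Literature.Probability.RandomPlanarGeometry.SAW

namespace HexCell

variable {C : Finset Cell → Finset Cell} {P₀ : Finset Cell → Cell → Cell}

/-- `LL (UR c) = c`. [cite: MadrasSlade1993, §3.2 (proof of Theorem 3.2.3)] -/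
theorem ll_ur (c : Cell) : LL (UR c) = c := Prod.ext (by simp) (by simp)

/-- `UR (LL c) = c`. [cite: MadrasSlade1993, §3.2 (proof of Theorem 3.2.3)] -/
theorem ur_ll (c : Cell) : UR (LL c) = c := Prod.ext (by simp) (by simp)

/-- A peeled hexagon is not the lower-left neighbour of the peelable top (it lies on a row `≤` the top's).
[cite: MadrasSlade1993, §3.2 (proof of Theorem 3.2.3)] -/
theorem ll_ne_of_peelable {S : Finset Cell} {m c : Cell} (hm : Peelable S m) (hc : c ∈ S) : LL c ≠ m := by
  intro e
  have h := hm.1.1.2 c hc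
  have e2 := congrArg Prod.snd e
  simp only [LL_snd] at e2
  rcases h with h | ⟨h, -⟩ <;> omega

/-- ★ **Ports off the peeled hexagons are the base ports**: `(omegaRec C P₀ S).2 c = P₀ (peel S) c` whenever `c ∉ S \ peel S` (in particular on the base
`peel S` and outside `S`). [cite: MadrasSlade1993, §3.2 (proof of Theorem 3.2.3)] -/
theorem omegaRec_port_eq_base {S : Finset Cell} {c : Cell} (hc : c ∉ S \ peel S) : (omegaRec C P₀ S).2 c = P₀ (peel S) c := by
  induction S using Finset.strongInduction generalizing c with
  | H S ih =>
    by_cases h : ∃ m, Peelable S m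
    · obtain ⟨m, hm⟩ := h
      have hcm : c ≠ m := by
        rintro rfl; exact hc (by rw [sdiff_peel_eq_insert hm]; exact mem_insert_self _ _)
      rw [omegaRec_eq_of_peelable hm]
      show Function.update _ _ _ c = _
      rw [Function.update_of_ne hcm, ih _ (erase_ssubset hm.mem), ← peel_eq_peel_erase hm]
      intro hc'
      exact hc (by rw [sdiff_peel_eq_insert hm]; exact mem_insert_of_mem hc')
    · rw [omegaRec_eq_base h, peel_eq_self h]

/-- ★ **The port of a peeled hexagon is `UR` of the port of its lower-left neighbour**: for `m ∈ S \ peel S`,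
`(omegaRec C P₀ S).2 m = UR ((omegaRec C P₀ S).2 (LL m))`. [cite: MadrasSlade1993, §3.2 (proof of Theorem 3.2.3)] -/
theorem omegaRec_port_eq_ur {S : Finset Cell} {m : Cell} (hm : m ∈ S \ peel S) :
    (omegaRec C P₀ S).2 m = UR ((omegaRec C P₀ S).2 (LL m)) := by
  induction S using Finset.strongInduction generalizing m with
  | H S ih =>
    by_cases h : ∃ m, Peelable S m
    · obtain ⟨m₀, hm₀⟩ := h
      have hne : LL m ≠ m₀ := ll_ne_of_peelable hm₀ (mem_sdiff.1 hm).1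
      rw [omegaRec_eq_of_peelable hm₀]
      show (Function.update _ _ _ : Cell → Cell) m = UR ((Function.update _ _ _ : Cell → Cell) (LL m))
      rw [Function.update_of_ne hne]
      by_cases e : m = m₀
      · subst e; rw [Function.update_self]
      · rw [Function.update_of_ne e]
        apply ih _ (erase_ssubset hm₀.mem)
        have := hm; rw [sdiff_peel_eq_insert hm₀, mem_insert] at this
        exact this.resolve_left e
    · rw [peel_eq_self h, sdiff_self] at hm; simp at hm

/-- ★★ **Closed form of the image**: `(omegaRec C P₀ S).1 = C (peel S) ∪ (S \ peel S).image (fun m ↦ LL ((omegaRec C P₀ S).2 m))` — the base image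
together with one hexagon `LL (port m)` for every peeled hexagon `m` (the rays). [cite: MadrasSlade1993, §3.2 (proof of Theorem 3.2.3)] -/
theorem omegaRec_image_eq (S : Finset Cell) :
    (omegaRec C P₀ S).1 = C (peel S) ∪ (S \ peel S).image (fun m => LL ((omegaRec C P₀ S).2 m)) := by
  induction S using Finset.strongInduction with
  | H S ih =>
    by_cases h : ∃ m, Peelable S m
    · obtain ⟨m₀, hm₀⟩ := h
      have hrec := ih _ (erase_ssubset hm₀.mem)
      rw [← peel_eq_peel_erase hm₀] at hrec
      -- the new port map agrees with the old one on `S.erase m₀ \ peel S`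
      have hagree : Set.EqOn (fun m => LL ((omegaRec C P₀ S).2 m)) (fun m => LL ((omegaRec C P₀ (S.erase m₀)).2 m))
          ↑(S.erase m₀ \ peel S) := by
        intro m hm
        have hm : m ∈ S.erase m₀ \ peel S := mem_coe.1 hm
        have hne : m ≠ m₀ := fun e => by rw [e] at hm; exact notMem_erase m₀ S (mem_sdiff.1 hm).1
        show LL ((omegaRec C P₀ S).2 m) = LL ((omegaRec C P₀ (S.erase m₀)).2 m)
        rw [omegaRec_eq_of_peelable hm₀]
        show LL ((Function.update _ _ _ : Cell → Cell) m) = _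
        rw [Function.update_of_ne hne]
      have htop : LL ((omegaRec C P₀ S).2 m₀) = (omegaRec C P₀ (S.erase m₀)).2 (LL m₀) := by
        rw [omegaRec_eq_of_peelable hm₀]
        show LL ((Function.update _ _ _ : Cell → Cell) m₀) = _
        rw [Function.update_self, ll_ur]
      have e1 : (omegaRec C P₀ S).1 = insert ((omegaRec C P₀ (S.erase m₀)).2 (LL m₀)) (omegaRec C P₀ (S.erase m₀)).1 := by
        rw [omegaRec_eq_of_peelable hm₀]
      have e2 : (S \ peel S).image (fun m => LL ((omegaRec C P₀ S).2 m)) =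
          insert ((omegaRec C P₀ (S.erase m₀)).2 (LL m₀)) ((S.erase m₀ \ peel S).image (fun m => LL ((omegaRec C P₀ (S.erase m₀)).2 m))) := by
        rw [sdiff_peel_eq_insert hm₀, ← peel_eq_peel_erase hm₀, image_insert, htop, image_congr hagree]
      rw [e1, e2, union_insert, ← hrec]
    · rw [omegaRec_eq_base h, peel_eq_self h, Finset.sdiff_self, image_empty, union_empty]

/-- ★ **Ports along a stick**: if `h` is not peeled and the stick `UR h, …, UR^i h` lies in `S \ peel S`, then the port of `UR^i h` is `UR^i` of the base
port of `h` — the ray over `P₀ (peel S) h`. [cite: MadrasSlade1993, §3.2 (proof of Theorem 3.2.3)] -/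
theorem omegaRec_port_urIter {S : Finset Cell} {h : Cell} (hh : h ∉ S \ peel S) :
    ∀ i : ℕ, (∀ j, 1 ≤ j → j ≤ i → urIter h j ∈ S \ peel S) → (omegaRec C P₀ S).2 (urIter h i) = urIter (P₀ (peel S) h) i
  | 0, _ => by rw [urIter_zero, urIter_zero, omegaRec_port_eq_base hh]
  | i + 1, hst => by
    rw [omegaRec_port_eq_ur (hst (i + 1) (by omega) le_rfl), ll_urIter_succ,
      omegaRec_port_urIter hh i (fun j hj hji => hst j hj (by omega)), ← urIter_succ]

/-- ★★ **Closed form, membership version** («base image plus rays»): `x ∈ (omegaRec C P₀ S).1` iff `x` lies in the base image `C (peel S)` or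
`x = UR^i (P₀ (peel S) h)` for a base hexagon `h` carrying a stick of length `≥ i + 1` in `S \ peel S` (by XII every peeled hexagon lies on such a stick
over a host of the base). [cite: MadrasSlade1993, §3.2 (proof of Theorem 3.2.3)] -/
theorem mem_omegaRec_iff {S : Finset Cell} {x : Cell} :
    x ∈ (omegaRec C P₀ S).1 ↔ x ∈ C (peel S) ∨
      ∃ h : Cell, ∃ i : ℕ, h ∈ peel S ∧ (∀ j, 1 ≤ j → j ≤ i + 1 → urIter h j ∈ S \ peel S) ∧ x = urIter (P₀ (peel S) h) i := by
  rw [omegaRec_image_eq, mem_union, mem_image]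
  apply or_congr_right
  constructor
  · rintro ⟨m, hm, rfl⟩
    obtain ⟨h, i, hhost, hi, hm', hst⟩ := exists_host_stick_of_mem_sdiff_peel hm
    obtain ⟨i, rfl⟩ : ∃ i', i = i' + 1 := ⟨i - 1, by omega⟩
    refine ⟨h, i, hhost.1, hst, ?_⟩
    rw [← hm', omegaRec_port_urIter (fun hh => (mem_sdiff.1 hh).2 hhost.1) (i + 1) hst, ll_urIter_succ]
  · rintro ⟨h, i, hB, hst, rfl⟩
    refine ⟨urIter h (i + 1), hst (i + 1) (by omega) le_rfl, ?_⟩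
    rw [omegaRec_port_urIter (fun hh => (mem_sdiff.1 hh).2 hB) (i + 1) hst, ll_urIter_succ]

/-- The ray hexagons of the closed form, host by host: the image of the stick cell `UR^{i+1} h` is `UR^i (P₀ (peel S) h)`.
[cite: MadrasSlade1993, §3.2 (proof of Theorem 3.2.3)] -/
theorem ll_omegaRec_port_urIter_succ {S : Finset Cell} {h : Cell} (hB : h ∈ peel S) {i : ℕ}
    (hst : ∀ j, 1 ≤ j → j ≤ i + 1 → urIter h j ∈ S \ peel S) :
    LL ((omegaRec C P₀ S).2 (urIter h (i + 1))) = urIter (P₀ (peel S) h) i := by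
  rw [omegaRec_port_urIter (fun hh => (mem_sdiff.1 hh).2 hB) (i + 1) hst, ll_urIter_succ]

/-- ★ **Rays are disjoint from the base image and the ray map is injective** (under the hypotheses of THEOREM V's recursion): with
`σ m := LL ((omegaRec C P₀ S).2 m)`, the set `(S \ peel S).image σ` has full cardinality `#(S \ peel S)` and misses `C (peel S)` — by
`card_omegaRec` (XXII) against the closed form. [cite: MadrasSlade1993, §3.2 (proof of Theorem 3.2.3)] -/
theorem injOn_ray_and_disjoint {X S : Finset Cell} (hS : IsBrickSet S) (hX : ∀ c ∈ S \ peel S, LL c ∉ X)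
    (hbase : PortInv X (peel S) (C (peel S)) (P₀ (peel S))) :
    Set.InjOn (fun m => LL ((omegaRec C P₀ S).2 m)) ↑(S \ peel S) ∧
      Disjoint (C (peel S)) ((S \ peel S).image (fun m => LL ((omegaRec C P₀ S).2 m))) := by
  classical
  have hcard := card_omegaRec hS hX hbase
  rw [omegaRec_image_eq] at hcard
  have h1 := card_union_add_card_inter (C (peel S)) ((S \ peel S).image (fun m => LL ((omegaRec C P₀ S).2 m)))
  have h2 : #((S \ peel S).image (fun m => LL ((omegaRec C P₀ S).2 m))) ≤ #(S \ peel S) := card_image_le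
  exact ⟨card_image_iff.1 (by omega), disjoint_iff_inter_eq_empty.2 (card_eq_zero.1 (by omega))⟩

end HexCell

end Literature.Probability.RandomPlanarGeometry.SAW
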